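import Literature.Computability.Complexity.CircuitLowerBoundsProofs
import Literature.Computability.Complexity.NegationElimination
import Literature.Computability.Complexity.RossmanMonotoneClique

/-!
# Route OneSlice, item `ShallowSliceBound` (stmt-PneNP-14083): binarising unbounded fan-in monotone circuits

Helper file (prover seat, 2026-08-16), def-free. Proves the registered stub `stub_binarise` of the crux skeleton
`Cruxes/ConstantBand/Lines/sharpness-sandwich.lean`: every circuit over `{∧ₘ, ∨ₘ | m}` (unbounded fan-in monotone
gates, constants `∧₀ = 1`, `∨₀ = 0`) on a finite input type with `N` inputs and `s` gates has a circuit over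
`{∧₂, ∨₂, 0, 1}` computing the same function with at most `(s+1)(s+N+1)` gates. Proof: induction over the
straight-line program in the gate-list calculus `CktSize` (`CircuitComposition.lean`): the values of all gates
form a multi-output map `x ↦ (m ↦ value of gate m)`; a new `∧ₘ`/`∨ₘ` gate reads a set of at most `N + L` DISTINCT
wires (inputs or the `L` earlier gates), so it is a chain of binary gates over that deduplicated list
(`cktSize_all` / `cktSize_any` of `CircuitLowerBoundsProofs.lean`), plus one constant gate for the junk outputs.
-/

set_option linter.dupNamespace false

namespace Summit.PneNP.PneNP.Theorems.ShallowSliceBound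

open Finset Literature.Computability.Complexity GateList

/-- The constant gates are in `{∧₂, ∨₂, 0, 1}`. [folklore] -/
theorem const_mem_monotoneBasis01' (b : Bool) : GateFn.const b ∈ monotoneBasis01 := by
  cases b
  · exact Set.mem_insert_of_mem _ (Set.mem_insert _ _)
  · exact Set.mem_insert _ _

/-- The constant multi-output map costs one gate over `{∧₂, ∨₂, 0, 1}`. [folklore] -/
theorem cktSize_const01 {κ μ : Type} (b : Bool) :
    CktSize monotoneBasis01 (fun (_ : κ → Bool) (_ : μ) => b) 1 := by
  have h := CktSize.gate (ι := κ) (B := monotoneBasis01) (GateFn.const b) (const_mem_monotoneBasis01' b) Fin.elim0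
  exact (h.outMap fun _ : μ => ()).congr fun _ _ => rfl

/-- The conjunction of a (possibly empty) list of wires over `{∧₂, ∨₂, 0, 1}`, at most `length + 1` gates. [folklore] -/
theorem cktSize_all01 {κ : Type} (l : List κ) :
    CktSize monotoneBasis01 (fun (w : κ → Bool) (_ : Unit) => l.all fun i => w i) (l.length + 1) := by
  rcases l.eq_nil_or_concat' with rfl | ⟨L, b, rfl⟩
  · exact (cktSize_const01 true).congr fun _ _ => by simp
  · have h := cktSize_all (L ++ [b]) (by simp)
    exact (h.basis_mono monotoneBasis_subset_monotoneBasis01).of_le (by simp)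

/-- The disjunction of a (possibly empty) list of wires over `{∧₂, ∨₂, 0, 1}`, at most `length + 1` gates. [folklore] -/
theorem cktSize_any01 {κ : Type} (l : List κ) :
    CktSize monotoneBasis01 (fun (w : κ → Bool) (_ : Unit) => l.any fun i => w i) (l.length + 1) := by
  rcases l.eq_nil_or_concat' with rfl | ⟨L, b, rfl⟩
  · exact (cktSize_const01 false).congr fun _ _ => by simp
  · have h := cktSize_any (L ++ [b]) (by simp)
    exact (h.basis_mono monotoneBasis_subset_monotoneBasis01).of_le (by simp)

section Gates

variable {ι : Type} [Fintype ι] [DecidableEq ι]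

omit [Fintype ι] [DecidableEq ι] in
/-- A gate over `{∧ₘ, ∨ₘ}` is an `∧ₘ` or an `∨ₘ`. [folklore] -/
theorem exists_and_or_of_mem_monotoneACBasis {g : Gate ι} (h : g.fn ∈ monotoneACBasis) :
    ∃ m : ℕ, ∃ args : Fin m → ι ⊕ ℕ, g = ⟨m, (GateFn.and m).2, args⟩ ∨ g = ⟨m, (GateFn.or m).2, args⟩ := by
  rw [monotoneACBasis, Set.mem_iUnion] at h
  obtain ⟨m, hm⟩ := h
  simp only [Set.mem_insert_iff, Set.mem_singleton_iff] at hm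
  rcases hm with hm | hm
  · obtain ⟨args, rfl⟩ := Gate.exists_eq_of_fn_eq hm
    exact ⟨m, args, Or.inl rfl⟩
  · obtain ⟨args, rfl⟩ := Gate.exists_eq_of_fn_eq hm
    exact ⟨m, args, Or.inr rfl⟩

/-- **One step**: from the values of the first `L` gates to the values after one more `∧ₘ`/`∨ₘ` gate, at cost
`≤ N + L + 2` binary/constant gates (deduplicate the wires it reads). [folklore] -/
theorem cktSize_step (L : ℕ) {m : ℕ} (isAnd : Bool) (args : Fin m → ι ⊕ ℕ) (hargs : ∀ a j, args a = .inr j → j < L) :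
    CktSize monotoneBasis01 (fun (w : ι ⊕ ℕ → Bool) (j : ℕ) =>
      if j < L then w (.inr j) else if j = L then
        (if isAnd then decide (∀ a, w (args a) = true) else decide (∃ a, w (args a) = true)) else false)
      (Fintype.card ι + L + 2) := by
  classical
  -- the deduplicated list of wires read by the gate
  set allW : List (ι ⊕ ℕ) := (univ : Finset ι).toList.map Sum.inl ++ (List.range L).map Sum.inr with hallW
  set ws : List (ι ⊕ ℕ) := allW.filter fun w => decide (w ∈ univ.image args) with hws
  have hlen : ws.length ≤ Fintype.card ι + L := by
    refine (List.length_filter_le _ _).trans ?_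
    rw [hallW, List.length_append, List.length_map, List.length_map, List.length_range, Finset.length_toList,
      card_univ]
  have hmem : ∀ w, w ∈ ws ↔ ∃ a, args a = w := by
    intro w
    rw [hws, List.mem_filter, decide_eq_true_eq, mem_image]
    constructor
    · rintro ⟨-, a, -, ha⟩; exact ⟨a, ha⟩
    · rintro ⟨a, rfl⟩
      refine ⟨?_, a, mem_univ _, rfl⟩
      rw [hallW, List.mem_append, List.mem_map, List.mem_map]
      rcases h : args a with i | j
      · exact Or.inl ⟨i, Finset.mem_toList.2 (mem_univ _), rfl⟩
      · exact Or.inr ⟨j, List.mem_range.2 (hargs a j h), rfl⟩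
  -- the gate as a function of the wire values
  have hop : ∀ w : ι ⊕ ℕ → Bool,
      (if isAnd then decide (∀ a, w (args a) = true) else decide (∃ a, w (args a) = true)) =
        (if isAnd then ws.all (fun i => w i) else ws.any (fun i => w i)) := by
    intro w
    cases isAnd
    · simp only [Bool.false_eq_true, ↓reduceIte]
      rw [Bool.eq_iff_iff, decide_eq_true_eq, List.any_eq_true]
      constructor
      · rintro ⟨a, ha⟩; exact ⟨args a, (hmem _).2 ⟨a, rfl⟩, ha⟩
      · rintro ⟨w', hw', hw⟩
        obtain ⟨a, rfl⟩ := (hmem w').1 hw'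
        exact ⟨a, hw⟩
    · simp only [↓reduceIte]
      rw [Bool.eq_iff_iff, decide_eq_true_eq, List.all_eq_true]
      constructor
      · intro h w' hw'
        obtain ⟨a, rfl⟩ := (hmem w').1 hw'
        exact h a
      · intro h a; exact h (args a) ((hmem _).2 ⟨a, rfl⟩)
  -- the pieces
  have hproj := CktSize.proj monotoneBasis01 (fun j : ℕ => (Sum.inr j : ι ⊕ ℕ))
  have hopSize : CktSize monotoneBasis01 (fun (w : ι ⊕ ℕ → Bool) (_ : Unit) =>
      if isAnd then ws.all (fun i => w i) else ws.any (fun i => w i)) (ws.length + 1) := by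
    cases isAnd
    · exact (cktSize_any01 ws).congr fun _ _ => by simp
    · exact (cktSize_all01 ws).congr fun _ _ => by simp
  have hfalse := cktSize_const01 (κ := ι ⊕ ℕ) (μ := Unit) false
  have hcomb := (hproj.pair hopSize).pair hfalse
  refine ((hcomb.outMap fun j : ℕ => if j < L then Sum.inl (Sum.inl j) else
    if j = L then Sum.inl (Sum.inr ()) else Sum.inr ()).congr fun w j => ?_).of_le (by omega)
  by_cases h1 : j < L
  · simp [h1]
  · by_cases h2 : j = L
    · subst h2
      simp only [lt_self_iff_false, ↓reduceIte, Sum.elim_inl, Sum.elim_inr]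
      exact (hop w).symm
    · simp [h1, h2]

/-- **All gate values of a `{∧ₘ, ∨ₘ}`-program are computable over `{∧₂, ∨₂, 0, 1}`** with at most
`L (L + N + 1) + 1` gates, `L` the length of the program. [folklore] -/
theorem cktSize_vals (gs : List (Gate ι)) (hwf : WF gs) (hB : ∀ g ∈ gs, g.fn ∈ monotoneACBasis) :
    CktSize monotoneBasis01 (fun (x : ι → Bool) (j : ℕ) => (vals gs x).getD j false)
      (gs.length * (gs.length + Fintype.card ι + 1) + 1) := by
  induction gs using List.reverseRecOn with
  | nil =>
    refine ((cktSize_const01 (κ := ι) (μ := ℕ) false).congr fun x j => ?_).of_le (by simp)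
    simp
  | append_singleton ms g ih =>
    have ih' := ih hwf.of_append_left fun g' hg' => hB g' (List.mem_append_left _ hg')
    have hg : GateOK ms.length g := hwf.getLast
    obtain ⟨m, args, hgeq⟩ := exists_and_or_of_mem_monotoneACBasis (hB g (by simp))
    set L := ms.length with hL
    -- which gate
    obtain ⟨isAnd, hop, hargs⟩ : ∃ isAnd : Bool,
        (∀ v : Fin g.arity → Bool, ∃ hma : m = g.arity, g.op v =
          if isAnd then decide (∀ a : Fin m, v (Fin.cast hma a) = true) else decide (∃ a : Fin m, v (Fin.cast hma a) = true)) ∧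
        (∃ hma : m = g.arity, ∀ a : Fin m, g.args (Fin.cast hma a) = args a) := by
      rcases hgeq with rfl | rfl
      · exact ⟨true, fun v => ⟨rfl, by simp [GateFn.and]⟩, rfl, fun a => rfl⟩
      · exact ⟨false, fun v => ⟨rfl, by simp [GateFn.or]⟩, rfl, fun a => rfl⟩
    obtain ⟨hma, hargs⟩ := hargs
    have hargsOK : ∀ a j, args a = .inr j → j < L := by
      intro a j h
      rw [← hargs a] at h
      exact hg _ j h
    have hstage1 := (CktSize.id monotoneBasis01).pair ih'
    have hstage2 := cktSize_step (ι := ι) L isAnd args hargsOK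
    have hcomp := hstage1.comp hstage2
    refine (hcomp.congr fun x j => ?_).of_le ?_
    · -- correctness
      rw [vals_append_singleton]
      by_cases h1 : j < L
      · rw [if_pos h1, List.getD_append _ _ _ _ (by rw [length_vals]; exact h1)]
        rfl
      · rw [if_neg h1, List.getD_append_right _ _ _ _ (by rw [length_vals]; omega)]
        by_cases h2 : j = L
        · subst h2
          rw [if_pos rfl, length_vals, Nat.sub_self, List.getD_cons_zero]
          obtain ⟨hma', hv⟩ := hop (fun a => wireOf x (vals ms x) (g.args a))
          rw [hv]
          have hw : ∀ a : Fin m, wireOf x (vals ms x) (g.args (Fin.cast hma' a)) =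
              Sum.elim x (fun j => (vals ms x).getD j false) (args a) := by
            intro a
            rw [show Fin.cast hma' a = Fin.cast hma a from rfl, hargs a]
            cases args a <;> rfl
          simp only [hw]
        · rw [if_neg h2, length_vals]
          rw [List.getD_eq_default]
          simp only [List.length_singleton]
          omega
    · -- size
      simp only [List.length_append, List.length_singleton]
      nlinarith

/-- **Binarisation** (the registered stub `stub_binarise` of stmt-PneNP-14083): every `{∧ₘ, ∨ₘ | m}`-circuit on a
finite input type has an `{∧₂, ∨₂, 0, 1}`-circuit computing the same function with at most `(|D|+1)(|D|+N+1)`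
gates. [folklore] -/
theorem stub_binarise :
    ∀ (ι : Type) [Fintype ι] [DecidableEq ι] (D : Circuit ι), D.IsOver monotoneACBasis →
      ∃ C : Circuit ι, C.IsOver monotoneBasis01 ∧ C.eval = D.eval ∧
        C.size ≤ (D.size + 1) * (D.size + Fintype.card ι + 1) := by
  intro ι _ _ D hD
  rcases hout : D.output with i | m
  · refine ⟨Circuit.input i, fun g hg => by simp [Circuit.input] at hg, ?_, by simp⟩
    funext x
    rw [Circuit.eval_input, circuit_eval, hout]
    rfl
  · have h := cktSize_vals D.gates (wf_gates D) hD
    obtain ⟨C, hCB, hCs, hCe⟩ := (h.outMap fun _ : Unit => m).toCircuit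
    refine ⟨C, hCB, ?_, ?_⟩
    · funext x
      rw [hCe, circuit_eval, hout]
      rfl
    · refine hCs.trans ?_
      rw [Circuit.size]
      nlinarith [Nat.zero_le (D.gates.length + Fintype.card ι)]

end Gates

end Summit.PneNP.PneNP.Theorems.ShallowSliceBound
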